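import Literature.NumberTheory.Automorphic.Liu2021.Def411WeilCarriersDoubling
import Literature.NumberTheory.GelbartRogawski1991.UnitaryDualPairSeesawCharacterLeft
import HarnessLib

/-!
# The `χ`-attached splitting of `U(V₁ ⊕ V₂) × U(W)` over a hermitian LINE, read on the orthogonal sum `diag dV₁ ⊕ᶠ diag dV₂`,
# and the V-side see-saw statement for the `χ`-splitting triple

[Liu2021, App. D §D.1 Steps 1–2 (l. 5217–5219)] attaches to a conjugate-symplectic character `μ` the splitting `ι_μ` of the
unitary dual pair determined by doubling ([Kudla1994, §2, Thm. 3.1]; [HarrisKudlaSweet1996, §1 (1.14)–(1.15)]); the tree's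
term for it is `chiSplittingLine` (`Def411WeilCarriersDoubling` §4).  For the see-saw pair
`(U(V₁) × U(V₂), U(W)) ↔ (U(V₁ ⊕ V₂), U(W))` ([Kudla1984, §1]) in the Kronecker coordinates of `UnitaryDualPairSeesawCharacterLeft`
the big group is `U(diag dV₁ ⊕ᶠ diag dV₂)`, while `chiSplittingLine` of `V₁ ⊕ V₂` lives over `diag (dV₁ ‖ dV₂)`; this file
transports along the on-the-nose identity `diag(a) ⊕ᶠ diag(b) = diag(a ‖ b)`:

* §1 `splittingCongrV` — transport of a splitting homomorphism (DATA) along equal V-side Gram data `T_V = T_V'`, `J_V = J_V'`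
  (the V-side mirror of `splittingCongr`), with `IsCompatible`, `Continuous` and `Continuous ∘ pairSplitting` riding along;
* §2 `finSum_diagonal_append` / `finSum_realDiagonal_append`: the orthogonal sum of two diagonal hermitian spaces is the diagonal
  space of the concatenated vector ON THE NOSE (generalising `finSum_diagonal_lineVec`), `complexConj_append`, `append_ne_zero`,
  `isUnit_det_finSum_realDiagonal`;
* §3 **`chiSplittingSum`** — the `χ`-attached splitting of `(U(diag(dV₁ ‖ dV₂)), U(⟨T_W⟩))` read over `diag dV₁ ⊕ᶠ diag dV₂`,
  compatible (`isCompatible_chiSplittingSum`), and the `Prop` **`seesawCharChiSplittingLineTrivial`**: for the `χ`-splitting triple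
  `(s_χ^{V₁ ⊕ V₂}, s_χ^{V₁}, s_χ^{V₂})` over the line `W = ⟨T_W⟩` — the SAME unitary `χ` with `χ|_{𝕀_{L⁺}} = ε_{L/L⁺}` on the three
  V-sides — the V-side see-saw character `mpSeesawCharLeft` is `1` at every `((g₁, 1), 1)`, `g₁ ∈ U(diag dV₁)(𝔸_{L⁺})`; by
  `mpSeesawCharLeft_spec` this reads `ω(s_χ^V((g₁ ⊕ᶠ 1) ⊗ 1)) (Φ₁ ⊠ Φ₂) = (ω(s_χ^{V₁}(g₁ ⊗ 1)) Φ₁) ⊠ Φ₂` — [Liu2021]'s «the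
  restriction of `ω_{μ,ε}` to `U(V⋆)` … with the same `μ`» (proof of Thm. 4.15, l. 2199–2210) for pure tensors.  It is PROVED in
  `Def411WeilCarriersDoublingSeesawLine` (`seesawCharChiSplittingLineTrivial_holds`, by doubling); it is stated here as a `Prop`
  because the Fourier–Jacobi see-saw assembly consumes it by name.  The U(W)-side character is NOT claimed trivial (there the three
  W-side characters differ: `ε^{N₁+N₂}` against `ε^{N₁}`, `ε^{N₂}`).

References: [Liu2021] Y. Liu, *Fourier–Jacobi cycles and arithmetic relative trace formula*, Camb. J. Math. 9 (2021), proof of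
Thm. 4.15 (arXiv `FJcycle.tex` l. 2199–2210), App. D §D.1 Steps 1–2 (l. 5217–5219); [GelbartRogawski1991] S. Gelbart, J. Rogawski,
Invent. Math. 105 (1991) §3.1 Prop. 3.1.1 p. 455, Remark p. 457; [Kudla1994] S. Kudla, Israel J. Math. 87 (1994) §2, Thm. 3.1;
[Kudla1984] S. Kudla, Progr. Math. 46 (1984) §1; [HarrisKudlaSweet1996] J. AMS 9 (1996) §1.
-/

set_option autoImplicit false

noncomputable section

open scoped Matrix
open NumberField
open Literature.NumberTheory.Weil1964 Literature.NumberTheory.Automorphic Literature.NumberTheory.Automorphic.UnitaryGroup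
open Literature.NumberTheory.GelbartRogawski1991 Literature.NumberTheory.GelbartRogawski1991.UnitaryDualPair
open Literature.NumberTheory.GelbartRogawski1991.GRConstruction
open Literature.RepresentationTheory.HarrisKudlaSweet1996
open Literature.NumberTheory.GaloisRepresentations

namespace Literature.NumberTheory.Automorphic.Liu2021.Def411WeilCarriersDoubling

/-! ## §1  Transport of a splitting homomorphism along equal V-side Gram data -/

section CongrV

variable (F E : Type) [Field F] [NumberField F] [Field E] [NumberField E] [Algebra F E]
variable (c : E ≃ₐ[F] E) (N M : ℕ) {n : ℕ} (e : Fin N × Fin M ≃ Fin n)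
variable {JV JV' : Matrix (Fin N) (Fin N) E} {TV TV' : Matrix (Fin N) (Fin N) F}
variable (JW : Matrix (Fin M) (Fin M) E) {TW : Matrix (Fin M) (Fin M) F}

/-- **Transport of a splitting homomorphism along equal V-side Gram data** `T_V = T_V'`, `J_V = J_V'` (the groups
`G₁(𝔸) = U(J_V ⊗ J_W)(𝔸)` and `Mp_ψ(𝕎_𝔸)ᶜᵒⁿᵗ`, `𝕎` with Gram matrix `T_V ⊗ T_W`, depend on them) — the V-side mirror of
`splittingCongr`. [cite: GelbartRogawski1991, §3.1 Prop. 3.1.1 p. 455 L1–3] -/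
def splittingCongrV (hT : TV = TV') (hJ : JV = JV')
    (s : UnitaryGroup.adelicPair F E c N M JV JW →* adelicMpCont F (Fin n) (adelicGram F e TV TW)) :
    UnitaryGroup.adelicPair F E c N M JV' JW →* adelicMpCont F (Fin n) (adelicGram F e TV' TW) := by
  subst hT hJ
  exact s

/-- transport along `rfl, rfl` is the identity. [cite: GelbartRogawski1991, §3.1 Prop. 3.1.1 p. 455 L1–3] -/
@[simp] theorem splittingCongrV_rfl
    (s : UnitaryGroup.adelicPair F E c N M JV JW →* adelicMpCont F (Fin n) (adelicGram F e TV TW)) :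
    splittingCongrV F E c N M e JW rfl rfl s = s := rfl

/-- a continuous splitting stays continuous under V-side transport. [cite: GelbartRogawski1991, §3.1 Prop. 3.1.1 p. 455 L1–3] -/
theorem continuous_splittingCongrV (hT : TV = TV') (hJ : JV = JV')
    {s : UnitaryGroup.adelicPair F E c N M JV JW →* adelicMpCont F (Fin n) (adelicGram F e TV TW)}
    (hc : Continuous s) : Continuous (splittingCongrV F E c N M e JW hT hJ s) := by
  subst hT hJ
  exact hc

/-- the pair splitting of the V-side transported splitting is continuous if that of `s` is. [cite: GelbartRogawski1991, §3.1 Prop. 3.1.1 p. 455 L1–3] -/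
theorem continuous_pairSplitting_splittingCongrV (hT : TV = TV') (hJ : JV = JV')
    {s : UnitaryGroup.adelicPair F E c N M JV JW →* adelicMpCont F (Fin n) (adelicGram F e TV TW)}
    (hsc : Continuous (pairSplitting F E c N M e JV JW s)) :
    Continuous (pairSplitting F E c N M e JV' JW (splittingCongrV F E c N M e JW hT hJ s)) := by
  subst hT hJ
  exact hsc

/-- **compatibility is transported along equal V-side Gram data**: if `s` is a compatible splitting of the datum at
`(T_V, J_V)` then `splittingCongrV hT hJ s` is one of the datum at `(T_V', J_V')`, for ANY proof arguments `hV' / hVd' / hJV'`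
of the latter (proof irrelevance). [cite: GelbartRogawski1991, §3.1 Prop. 3.1.1 p. 455 L1–3; Remark p. 457 L4] -/
theorem isCompatible_splittingCongrV [Algebra.IsQuadraticExtension F E] {δ : E} (hcδ : c δ = -δ) (hδ : δ ≠ 0)
    {d : F} (hd : δ * δ = algebraMap F E d) (hT : TV = TV') (hJ : JV = JV')
    (hV : TV.IsSymm) (hV' : TV'.IsSymm) (hVd : IsUnit TV.det) (hVd' : IsUnit TV'.det)
    (hJV : JV = TV.map (algebraMap F E)) (hJV' : JV' = TV'.map (algebraMap F E))
    (hW : TW.IsSymm) (hWd : IsUnit TW.det) (hJW : JW = TW.map (algebraMap F E))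
    {s : UnitaryGroup.adelicPair F E c N M JV JW →* adelicMpCont F (Fin n) (adelicGram F e TV TW)}
    (hs : (splittingDatum F E c N M e JV JW hcδ hδ hd hV hW hVd hWd hJV hJW).IsCompatible s) :
    (splittingDatum F E c N M e JV' JW hcδ hδ hd hV' hW hVd' hWd hJV' hJW).IsCompatible
      (splittingCongrV F E c N M e JW hT hJ s) := by
  subst hT hJ
  exact hs

end CongrV

/-! ## §2  The orthogonal sum of two diagonal hermitian spaces is diagonal ON THE NOSE -/

section Append

/-- `diag(a) ⊕ᶠ diag(b) = diag(a ‖ b)` (concatenated `Fin` basis, `Fin.append`). [cite: Kudla1984, §1] -/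
theorem finSum_diagonal_append {S : Type*} [CommRing S] {N₁ N₂ : ℕ} (a : Fin N₁ → S) (b : Fin N₂ → S) :
    finSum N₁ N₂ (Matrix.diagonal a) (Matrix.diagonal b) = Matrix.diagonal (Fin.append a b) := by
  rw [finSum, Matrix.fromBlocks_diagonal, Matrix.reindex_apply, Matrix.submatrix_diagonal_equiv]
  congr 1
  funext k
  refine Fin.addCases (fun i => ?_) (fun j => ?_) k
  · rw [Fin.append_left, Function.comp_apply, finSumFinEquiv_symm_apply_castAdd, Sum.elim_inl]
  · rw [Fin.append_right, Function.comp_apply, finSumFinEquiv_symm_apply_natAdd, Sum.elim_inr]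

variable (L : Type) [Field L] [NumberField L] [IsCMField L] {N₁ N₂ : ℕ}
  (a : Fin N₁ → L) (b : Fin N₂ → L)

/-- the concatenation of two conjugation-fixed vectors is conjugation-fixed. [cite: Liu2021, App. D §D.1 Step 1 (l. 5217)] -/
theorem complexConj_append (ha : ∀ i, IsCMField.complexConj L (a i) = a i) (hb : ∀ j, IsCMField.complexConj L (b j) = b j) :
    ∀ k, IsCMField.complexConj L (Fin.append a b k) = Fin.append a b k := fun k =>
  Fin.addCases (motive := fun k => IsCMField.complexConj L (Fin.append a b k) = Fin.append a b k)
    (fun i => by rw [Fin.append_left]; exact ha i) (fun j => by rw [Fin.append_right]; exact hb j) k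

/-- the concatenation of two nowhere-zero vectors is nowhere zero. [cite: Liu2021, App. D §D.1 Step 1 (l. 5217)] -/
theorem append_ne_zero {α : Type*} [Zero α] {m₁ m₂ : ℕ} (u : Fin m₁ → α) (v : Fin m₂ → α)
    (hu : ∀ i, u i ≠ 0) (hv : ∀ j, v j ≠ 0) : ∀ k, Fin.append u v k ≠ 0 := fun k =>
  Fin.addCases (motive := fun k => Fin.append u v k ≠ 0)
    (fun i => by rw [Fin.append_left]; exact hu i) (fun j => by rw [Fin.append_right]; exact hv j) k

/-- `diag(a) ⊕ᶠ diag(b) = diag(a ‖ b)` for the real Gram matrices over `L⁺`. [cite: Kudla1984, §1] -/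
theorem finSum_realDiagonal_append (ha : ∀ i, IsCMField.complexConj L (a i) = a i)
    (hb : ∀ j, IsCMField.complexConj L (b j) = b j) :
    finSum N₁ N₂ (realDiagonal L a ha) (realDiagonal L b hb) =
      realDiagonal L (Fin.append a b) (complexConj_append L a b ha hb) := by
  rw [realDiagonal, realDiagonal, realDiagonal, finSum_diagonal_append]
  congr 1
  funext k
  apply Subtype.ext
  refine Fin.addCases (motive := fun k => ((Fin.append (fun i => (⟨a i, (IsCMField.complexConj_eq_self_iff (K := L) (a i)).1 (ha i)⟩ :
      ↥(maximalRealSubfield L))) (fun j => (⟨b j, (IsCMField.complexConj_eq_self_iff (K := L) (b j)).1 (hb j)⟩ :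
      ↥(maximalRealSubfield L))) k : ↥(maximalRealSubfield L)) : L) = Fin.append a b k) (fun i => ?_) (fun j => ?_) k
  · rw [Fin.append_left, Fin.append_left]
  · rw [Fin.append_right, Fin.append_right]

/-- `det (diag(a) ⊕ᶠ diag(b))` is a unit when all entries are non-zero. [cite: Kudla1984, §1] -/
theorem isUnit_det_finSum_realDiagonal (ha : ∀ i, IsCMField.complexConj L (a i) = a i)
    (hb : ∀ j, IsCMField.complexConj L (b j) = b j) (ha0 : ∀ i, a i ≠ 0) (hb0 : ∀ j, b j ≠ 0) :
    IsUnit (finSum N₁ N₂ (realDiagonal L a ha) (realDiagonal L b hb)).det := by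
  rw [finSum_realDiagonal_append]
  exact isUnit_det_realDiagonal L _ _ (append_ne_zero a b ha0 hb0)

end Append

/-! ## §3  The socket: the V-side see-saw character of the `χ`-splitting triple is trivial on `U(V₁)(𝔸) × 1 × 1` -/

section Socket

variable (L : Type) [Field L] [NumberField L] [IsCMField L]

/-- the `χ`-attached splitting of `(U(diag(dV₁ ‖ dV₂)), U(⟨T_W⟩))` read over the Gram data `diag dV₁ ⊕ᶠ diag dV₂` of
`UnitaryDualPairSeesawCharacterLeft` (V-side transport along `finSum_diagonal_append` / `finSum_realDiagonal_append`).
[cite: Liu2021, App. D §D.1 Steps 1–2 (l. 5217–5219)] [cite: Kudla1994, §2 (doubled space, Siegel parabolic), Thm. 3.1] -/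
def chiSplittingSum {N₁ N₂ n : ℕ} (eV : Fin (N₁ + N₂) × Fin 1 ≃ Fin n)
    (dV₁ : Fin N₁ → L) (hdV₁ : ∀ i, IsCMField.complexConj L (dV₁ i) = dV₁ i) (hdV₁0 : ∀ i, dV₁ i ≠ 0)
    (dV₂ : Fin N₂ → L) (hdV₂ : ∀ i, IsCMField.complexConj L (dV₂ i) = dV₂ i) (hdV₂0 : ∀ i, dV₂ i ≠ 0)
    (χ : HeckeCharacter L) (hχu : χ.IsUnitary) (hχs : IsSplittingChar L 1 χ)
    (TW : Matrix (Fin 1) (Fin 1) (Fp L)) (hWd : IsUnit TW.det) (JW : Matrix (Fin 1) (Fin 1) L)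
    (hJW : JW = TW.map (algebraMap (Fp L) L)) :
    UnitaryGroup.adelicPair (Fp L) L (IsCMField.complexConj L) (N₁ + N₂) 1
        (finSum N₁ N₂ (Matrix.diagonal dV₁) (Matrix.diagonal dV₂)) JW →*
      adelicMpCont (Fp L) (Fin n) (adelicGram (Fp L) eV (finSum N₁ N₂ (realDiagonal L dV₁ hdV₁) (realDiagonal L dV₂ hdV₂)) TW) :=
  splittingCongrV (Fp L) L (IsCMField.complexConj L) (N₁ + N₂) 1 eV JW
    (finSum_realDiagonal_append L dV₁ dV₂ hdV₁ hdV₂).symm (finSum_diagonal_append dV₁ dV₂).symm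
    (chiSplittingLine L eV (Fin.append dV₁ dV₂) (complexConj_append L dV₁ dV₂ hdV₁ hdV₂)
      (append_ne_zero dV₁ dV₂ hdV₁0 hdV₂0) χ hχu hχs TW hWd JW hJW)

/-- `chiSplittingSum` is a compatible splitting of the SUM datum of `UnitaryDualPairSeesawCharacterLeft` (for ANY proof
arguments of the datum). [cite: GelbartRogawski1991, §3.1 Prop. 3.1.1 p. 455 L1–3] -/
theorem isCompatible_chiSplittingSum {N₁ N₂ n : ℕ} (eV : Fin (N₁ + N₂) × Fin 1 ≃ Fin n)
    (dV₁ : Fin N₁ → L) (hdV₁ : ∀ i, IsCMField.complexConj L (dV₁ i) = dV₁ i) (hdV₁0 : ∀ i, dV₁ i ≠ 0)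
    (dV₂ : Fin N₂ → L) (hdV₂ : ∀ i, IsCMField.complexConj L (dV₂ i) = dV₂ i) (hdV₂0 : ∀ i, dV₂ i ≠ 0)
    (χ : HeckeCharacter L) (hχu : χ.IsUnitary) (hχs : IsSplittingChar L 1 χ)
    (TW : Matrix (Fin 1) (Fin 1) (Fp L)) (hW : TW.IsSymm) (hWd : IsUnit TW.det) (JW : Matrix (Fin 1) (Fin 1) L)
    (hJW : JW = TW.map (algebraMap (Fp L) L))
    (hV : (finSum N₁ N₂ (realDiagonal L dV₁ hdV₁) (realDiagonal L dV₂ hdV₂)).IsSymm)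
    (hVd : IsUnit (finSum N₁ N₂ (realDiagonal L dV₁ hdV₁) (realDiagonal L dV₂ hdV₂)).det)
    (hJV : finSum N₁ N₂ (Matrix.diagonal dV₁) (Matrix.diagonal dV₂) =
      (finSum N₁ N₂ (realDiagonal L dV₁ hdV₁) (realDiagonal L dV₂ hdV₂)).map (algebraMap (Fp L) L)) :
    (splittingDatum (Fp L) L (IsCMField.complexConj L) (N₁ + N₂) 1 eV
        (finSum N₁ N₂ (Matrix.diagonal dV₁) (Matrix.diagonal dV₂)) JW (complexConj_imagUnit L) (imagUnit_ne_zero L)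
        (imagUnit_mul_self L) hV hW hVd hWd hJV hJW).IsCompatible
      (chiSplittingSum L eV dV₁ hdV₁ hdV₁0 dV₂ hdV₂ hdV₂0 χ hχu hχs TW hWd JW hJW) :=
  isCompatible_splittingCongrV (Fp L) L (IsCMField.complexConj L) (N₁ + N₂) 1 eV JW (complexConj_imagUnit L)
    (imagUnit_ne_zero L) (imagUnit_mul_self L) (finSum_realDiagonal_append L dV₁ dV₂ hdV₁ hdV₂).symm
    (finSum_diagonal_append dV₁ dV₂).symm (realDiagonal_isSymm L _ (complexConj_append L dV₁ dV₂ hdV₁ hdV₂)) hV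
    (isUnit_det_realDiagonal L _ (complexConj_append L dV₁ dV₂ hdV₁ hdV₂) (append_ne_zero dV₁ dV₂ hdV₁0 hdV₂0)) hVd
    (realDiagonal_map L _ (complexConj_append L dV₁ dV₂ hdV₁ hdV₂)).symm hJV hW hWd hJW
    (isCompatible_chiSplittingLine L eV (Fin.append dV₁ dV₂) (complexConj_append L dV₁ dV₂ hdV₁ hdV₂)
      (append_ne_zero dV₁ dV₂ hdV₁0 hdV₂0) χ hχu hχs TW hW hWd JW hJW)

/-- **The V-side see-saw statement for the `χ`-splitting triple** (a `Prop`; proved in `Def411WeilCarriersDoublingSeesawLine`):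
the V-side see-saw character `mpSeesawCharLeft` of the
`χ`-splitting triple `(s_χ^{V₁ ⊕ V₂}, s_χ^{V₁}, s_χ^{V₂})` over the line `W = ⟨T_W⟩` is `1` at every `((g₁, 1), 1)`,
`g₁ ∈ U(diag dV₁)(𝔸_{L⁺})` — [Liu2021]'s «with the same `μ`» restriction for the `χ`-normalised Weil representations.
[cite: Liu2021, Thm. 4.15 proof l. 2199–2210] [cite: Kudla1994, §2 (doubled space, Siegel parabolic), Thm. 3.1]
[cite: GelbartRogawski1991, §3.1 Prop. 3.1.1 p. 455, Remark p. 457] -/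
def seesawCharChiSplittingLineTrivial : Prop :=
  ∀ (L : Type) [Field L] [NumberField L] [IsCMField L] {N₁ N₂ n n₁ n₂ : ℕ}
    (eV : Fin (N₁ + N₂) × Fin 1 ≃ Fin n) (e₁ : Fin N₁ × Fin 1 ≃ Fin n₁) (e₂ : Fin N₂ × Fin 1 ≃ Fin n₂)
    (dV₁ : Fin N₁ → L) (hdV₁ : ∀ i, IsCMField.complexConj L (dV₁ i) = dV₁ i) (hdV₁0 : ∀ i, dV₁ i ≠ 0)
    (dV₂ : Fin N₂ → L) (hdV₂ : ∀ i, IsCMField.complexConj L (dV₂ i) = dV₂ i) (hdV₂0 : ∀ i, dV₂ i ≠ 0)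
    (χ : HeckeCharacter L) (hχu : χ.IsUnitary) (hχs : IsSplittingChar L 1 χ)
    (TW : Matrix (Fin 1) (Fin 1) (Fp L)) (hW : TW.IsSymm) (hWd : IsUnit TW.det) (JW : Matrix (Fin 1) (Fin 1) L)
    (hJW : JW = TW.map (algebraMap (Fp L) L))
    (g₁ : ↥(UnitaryGroup.adelic (Fp L) L (IsCMField.complexConj L) N₁ (Matrix.diagonal dV₁))),
    mpSeesawCharLeft (Fp L) L (IsCMField.complexConj L) N₁ N₂ 1 eV e₁ e₂ (Matrix.diagonal dV₁) (Matrix.diagonal dV₂) JW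
        (complexConj_imagUnit L) (imagUnit_ne_zero L) (imagUnit_mul_self L) (realDiagonal_isSymm L dV₁ hdV₁)
        (realDiagonal_isSymm L dV₂ hdV₂) hW (isUnit_det_realDiagonal L dV₁ hdV₁ hdV₁0)
        (isUnit_det_realDiagonal L dV₂ hdV₂ hdV₂0) hWd (isUnit_det_finSum_realDiagonal L dV₁ dV₂ hdV₁ hdV₂ hdV₁0 hdV₂0)
        (realDiagonal_map L dV₁ hdV₁).symm (realDiagonal_map L dV₂ hdV₂).symm hJW
        (isCompatible_chiSplittingSum L eV dV₁ hdV₁ hdV₁0 dV₂ hdV₂ hdV₂0 χ hχu hχs TW hW hWd JW hJW _ _ _)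
        (isCompatible_chiSplittingLine L e₁ dV₁ hdV₁ hdV₁0 χ hχu hχs TW hW hWd JW hJW)
        (isCompatible_chiSplittingLine L e₂ dV₂ hdV₂ hdV₂0 χ hχu hχs TW hW hWd JW hJW)
        ((g₁, 1), 1) = 1

end Socket

end Literature.NumberTheory.Automorphic.Liu2021.Def411WeilCarriersDoubling

end
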